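import Summits.MatrixMultiplication.OmegaCensus.ThreeSetLineUnitObstruction
import Mathlib.RingTheory.AdjoinRoot
import HarnessLib

/-!
# Two-number certificates `(ℓ, r)` for the three-set line identity: the `Bool` checker and its soundness

ω-census `pub-omega`, family (b3), seat pub-omega-group gen 41.  Framing: lottery ticket; floor = certified bounds/negative
ranges.  VALUE: a kernel TOOL for the three-set cube cells `(4, d, e)@p²` (front-end of `ThreeSetLineUnitObstruction`); NOT
progress on ω.

A certificate for an `X`-datum `F` against the killer `W` is `(ℓ, D, r₁, r₂)`: the commutative ring
`R = 𝔽_ℓ[X]/(X² − D)` (`AdjoinRoot`; `D = 0` for a split prime `ℓ ≡ 1 (mod p)`, `D` a non-residue for `ℓ ≡ −1 (mod p)`), the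
element `r = r₁ + r₂ X` with `Σ_{i<p} r^i = 0`, and the claims `D(xw̄, x̄w) = 0` and, for every hole `s`, one of
`Γ_s ≠ 0`, `N_s ≠ 0`, `N'_s ≠ 0` (`ThreeSetLineUnitObstruction.no_line_identity3_of_local`).  All arithmetic is on pairs of
naturals mod `ℓ` (`pmul`, `padd`, `hornerP`, …); `toR` maps a pair to `R` and the `toR_*` lemmas say the pair functions compute
in `R`; `toR_eq` (a monic quadratic divides no non-zero linear polynomial) turns "pairs differ mod `ℓ`" into "`≠` in `R`".
* `certCover p W F c` — the list of holes (flags for `s = 0 … p−1`) that the certificate `c` refutes for the datum `F`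
  (empty unless `1 < ℓ`, the lengths are `p`, `Σ_{i<p} r^i = 0` and `D_X = 0`);
* `datumChk p W F cs` — every hole is refuted by some certificate in the list `cs`;  **`datumChk_sound`**;
* `blockChk p W Fs css` / **`blockChk_sound`** — a list of data against a parallel list of certificate lists, with the
  conclusion in the semantic shape of `hkill` (`ThreeSetZpCells4Core`): no `G`, `s`, `K` solve the identity (any bound `e`);
* `blockChkN p W Fs N` / **`blockChkN_sound`** — the same with the certificates read from ONE numeral (16-bit units:
  per datum `[#certs]`, per certificate `[u] [ℓ: u units] [D] [r₁: u units] [r₂: u units]`, little-endian).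
Measured cost (farm, `decide +kernel`, p = 29, |X| = 5, one certificate per datum read from the numeral): ≈ 70 ms per datum
(680 data of `(4,5,14)@841` in 48 s) — the pair arithmetic is not packed, so this kit is NOT faster per datum than the packed
dual-vector kits; its point is the size of a certificate (≈ 8 sixteen-bit units instead of `p + 1` numbers) and, mainly, its
role as the EXCEPTION handler of the norm filter (`RESULTS-g41.md` of the seat notes, HOME/pub-omega-group-g41/): at `p = 29`
only ≈ 0.1 % of the `X`-data survive the divisibility test `N(D_X) ∣ N(Γ_s)` and need a local certificate at all.  The python
twin (encoder `encode_certs`, checker `datum_chk`) is `code/unit2.py` there; all 949 313 certifiable data of `(4,5,14)@841`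
(kit j330590 converted) pass it.
-/

namespace Summit.MatrixMultiplication.OmegaCensus

open Finset Polynomial

namespace LineUnit

/-! ## Pair arithmetic mod `ℓ` (elements `a + b·X` of `𝔽_ℓ[X]/(X² − D)` as `(a, b)`) -/

/-- Product of pairs: `(a₁ + a₂X)(b₁ + b₂X) = (a₁b₁ + a₂b₂D) + (a₁b₂ + a₂b₁)X`. [folklore] -/
def pmul (l D : ℕ) (a b : ℕ × ℕ) : ℕ × ℕ := ((a.1 * b.1 + a.2 * b.2 * D) % l, (a.1 * b.2 + a.2 * b.1) % l)

/-- Sum of pairs. [folklore] -/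
def padd (l : ℕ) (a b : ℕ × ℕ) : ℕ × ℕ := ((a.1 + b.1) % l, (a.2 + b.2) % l)

/-- Equality of pairs mod `ℓ`. [folklore] -/
def peq (l : ℕ) (a b : ℕ × ℕ) : Bool := a.1 % l == b.1 % l && a.2 % l == b.2 % l

/-- Horner evaluation `Σ_i L[i]·r^i` of a count vector at a pair. [folklore] -/
def hornerP (l D : ℕ) (r : ℕ × ℕ) : List ℕ → ℕ × ℕ
  | [] => (0, 0)
  | v :: L => padd l (v, 0) (pmul l D (hornerP l D r L) r)

/-- Powers of a pair. [folklore] -/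
def powP (l D : ℕ) (a : ℕ × ℕ) : ℕ → ℕ × ℕ
  | 0 => (1 % l, 0)
  | n + 1 => pmul l D (powP l D a n) a

/-- `(Σ_{i<n} r^i, r^n)`. [folklore] -/
def geomP (l D : ℕ) (r : ℕ × ℕ) : ℕ → (ℕ × ℕ) × (ℕ × ℕ)
  | 0 => ((0, 0), (1 % l, 0))
  | n + 1 => (padd l (geomP l D r n).1 (geomP l D r n).2, pmul l D (geomP l D r n).2 r)

/-- Hole flags: with `z = r^s`, `z' = r̄^s` running over `s = s₀, s₀+1, …` (`n` steps), flag `s` is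
`Γ_s ≠ 0 ∨ N_s ≠ 0 ∨ N'_s ≠ 0`, i.e. `w̄²z² + w²z'² ≢ ww̄ ∨ z'·m ≢ z·T ∨ z·m̄ ≢ z'·T`. [folklore] -/
def coverAux (l D : ℕ) (r ri w2 wc2 wwc T m mc : ℕ × ℕ) : ℕ → ℕ × ℕ → ℕ × ℕ → List Bool
  | 0, _, _ => []
  | n + 1, z, z' =>
    (!(peq l (padd l (pmul l D wc2 (pmul l D z z)) (pmul l D w2 (pmul l D z' z'))) wwc) ||
      !(peq l (pmul l D z' m) (pmul l D z T)) || !(peq l (pmul l D z mc) (pmul l D z' T))) ::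
    coverAux l D r ri w2 wc2 wwc T m mc n (pmul l D z r) (pmul l D z' ri)

/-- The holes refuted by one certificate `c = (ℓ, D, r₁, r₂)` for the datum `F` against `W` (all `p` flags `false` unless the
certificate is well-formed: `1 < ℓ`, lengths `p`, `Σ_{i<p} r^i = 0`, `D(xw̄, x̄w) = 0`). [folklore] -/
def certCover (p : ℕ) (W F : List ℕ) (c : ℕ × ℕ × ℕ × ℕ) : List Bool :=
  let l := c.1
  let D := c.2.1
  let r : ℕ × ℕ := (c.2.2.1, c.2.2.2)
  let ri := powP l D r (p - 1)
  let w := hornerP l D r W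
  let wc := hornerP l D ri W
  let x := hornerP l D r F
  let xc := hornerP l D ri F
  let A := pmul l D x wc
  let B := pmul l D xc w
  let DX := padd l (padd l (pmul l D A A) (pmul l D A B)) (pmul l D B B)
  if (1 < l) ∧ W.length = p ∧ F.length = p ∧ peq l (geomP l D r p).1 (0, 0) = true ∧ peq l DX (0, 0) = true then
    coverAux l D r ri (pmul l D w w) (pmul l D wc wc) (pmul l D w wc) (padd l A B) (pmul l D w x) (pmul l D wc xc) p
      (1 % l, 0) (1 % l, 0)
  else []

/-- A datum is refuted when every hole `s < p` is refuted by some certificate of its list. [folklore] -/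
def datumChk (p : ℕ) (W F : List ℕ) (cs : List (ℕ × ℕ × ℕ × ℕ)) : Bool :=
  let covs := cs.map (certCover p W F)
  (List.range p).all fun s => covs.any fun L => L.getD s false

/-- A block of data against a parallel list of certificate lists. [folklore] -/
def blockChk (p : ℕ) (W : List ℕ) : List (List ℕ) → List (List (ℕ × ℕ × ℕ × ℕ)) → Bool
  | [], _ => true
  | F :: Fs, cs :: css => datumChk p W F cs && blockChk p W Fs css
  | _ :: _, [] => false

/-! ### Certificates read from one numeral (16-bit units) -/

/-- Units `[i, i + n)` of the numeral `N` (little-endian base `2^16`). [folklore] -/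
def units (N i n : ℕ) : ℕ := (N >>> (16 * i)) % 2 ^ (16 * n)

/-- `n` certificates starting at unit `i`: returns them and the next position. [folklore] -/
def readCerts (N : ℕ) : ℕ → ℕ → List (ℕ × ℕ × ℕ × ℕ) × ℕ
  | 0, i => ([], i)
  | n + 1, i =>
    let u := units N i 1
    let c : ℕ × ℕ × ℕ × ℕ := (units N (i + 1) u, units N (i + 1 + u) 1, units N (i + 2 + u) u, units N (i + 2 + 2 * u) u)
    let rest := readCerts N n (i + 2 + 3 * u)
    (c :: rest.1, rest.2)

/-- The certificate lists of a block of data, read sequentially from `N` starting at unit `i`. [folklore] -/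
def certsOfN (N : ℕ) : List (List ℕ) → ℕ → List (List (ℕ × ℕ × ℕ × ℕ))
  | [], _ => []
  | _ :: Fs, i =>
    let rc := readCerts N (units N i 1) (i + 1)
    rc.1 :: certsOfN N Fs rc.2

/-- A block of data against the certificates packed in the numeral `N`. [folklore] -/
def blockChkN (p : ℕ) (W : List ℕ) (Fs : List (List ℕ)) (N : ℕ) : Bool := blockChk p W Fs (certsOfN N Fs 0)

/-! ## Semantics in `R = 𝔽_ℓ[X]/(X² − D)` -/

section Semantics

variable (l D : ℕ)

/-- The quadratic `X² − D` over `ZMod ℓ`. [folklore] -/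
noncomputable def quadPoly : (ZMod l)[X] := X ^ 2 - C ((D : ℕ) : ZMod l)

/-- The ring `R = 𝔽_ℓ[X]/(X² − D)` (a commutative ring for every `ℓ`, `D`). [folklore] -/
abbrev QR : Type := AdjoinRoot (quadPoly l D)

/-- A pair `(a, b)` read in `R` as `a + b·X`. [folklore] -/
noncomputable def toR (a : ℕ × ℕ) : QR l D := (a.1 : QR l D) + (a.2 : QR l D) * AdjoinRoot.root (quadPoly l D)

variable {l D}

/-- Reduction mod `ℓ` is invisible in `R`. [folklore] -/
theorem cast_mod (n : ℕ) : ((n % l : ℕ) : QR l D) = (n : QR l D) := by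
  rw [← map_natCast (AdjoinRoot.of (quadPoly l D)), ZMod.natCast_mod, map_natCast]

/-- `X² = D` in `R`. [folklore] -/
theorem root_sq : AdjoinRoot.root (quadPoly l D) ^ 2 = (D : QR l D) := by
  have h := AdjoinRoot.eval₂_root (quadPoly l D)
  rw [quadPoly, eval₂_sub, eval₂_X_pow, eval₂_C, map_natCast, sub_eq_zero] at h
  exact h

/-- `toR` is multiplicative. [folklore] -/
theorem toR_pmul (a b : ℕ × ℕ) : toR l D (pmul l D a b) = toR l D a * toR l D b := by
  unfold toR pmul
  simp only [cast_mod]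
  push_cast
  linear_combination (-((a.2 : QR l D) * (b.2 : QR l D))) * (root_sq (l := l) (D := D))

/-- `toR` is additive. [folklore] -/
theorem toR_padd (a b : ℕ × ℕ) : toR l D (padd l a b) = toR l D a + toR l D b := by
  unfold toR padd
  simp only [cast_mod]
  push_cast
  ring

/-- `toR (1 % ℓ, 0) = 1`, `toR (0, 0) = 0`. [folklore] -/
theorem toR_one : toR l D (1 % l, 0) = 1 := by
  unfold toR; rw [cast_mod]; push_cast; ring

/-- [folklore] -/
theorem toR_zero : toR l D (0, 0) = 0 := by
  unfold toR; push_cast; ring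

/-- Horner evaluation computes `Σ_{i < |L|} L[i]·ρ^i`. [folklore] -/
theorem toR_hornerP (r : ℕ × ℕ) : ∀ L : List ℕ,
    toR l D (hornerP l D r L) = ∑ i ∈ range L.length, (L.getD i 0 : QR l D) * toR l D r ^ i
  | [] => by rw [hornerP, toR_zero]; simp
  | v :: L => by
    rw [hornerP, toR_padd, toR_pmul, toR_hornerP r L, List.length_cons, Finset.sum_range_succ']
    simp only [List.getD_cons_succ, List.getD_cons_zero, pow_zero, mul_one, pow_succ]
    have hv : toR l D (v, 0) = (v : QR l D) := by unfold toR; push_cast; ring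
    rw [hv, Finset.sum_mul, add_comm]
    exact congrArg (· + (v : QR l D)) (Finset.sum_congr rfl fun i _ => by ring)

/-- Powers. [folklore] -/
theorem toR_powP (a : ℕ × ℕ) : ∀ n, toR l D (powP l D a n) = toR l D a ^ n
  | 0 => by rw [powP, toR_one, pow_zero]
  | n + 1 => by rw [powP, toR_pmul, toR_powP a n, pow_succ]

/-- Geometric sums. [folklore] -/
theorem toR_geomP (r : ℕ × ℕ) : ∀ n, toR l D (geomP l D r n).1 = ∑ i ∈ range n, toR l D r ^ i ∧
    toR l D (geomP l D r n).2 = toR l D r ^ n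
  | 0 => by rw [geomP, toR_zero, toR_one]; simp
  | n + 1 => by
    obtain ⟨h1, h2⟩ := toR_geomP r n
    refine ⟨?_, ?_⟩
    · rw [geomP, toR_padd, h1, h2, Finset.sum_range_succ]
    · rw [geomP, toR_pmul, h2, pow_succ]

/-- **Injectivity mod `ℓ`**: `toR a = toR b` forces `a ≡ b` componentwise mod `ℓ` (`1 < ℓ`): the monic quadratic `X² − D`
divides no non-zero polynomial of degree `≤ 1`. [folklore] -/
theorem toR_eq (hl : 1 < l) {a b : ℕ × ℕ} (h : toR l D a = toR l D b) : a.1 % l = b.1 % l ∧ a.2 % l = b.2 % l := by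
  haveI : Fact (1 < l) := ⟨hl⟩
  set f := quadPoly l D with hf
  have hmk : AdjoinRoot.mk f (C ((a.2 : ZMod l) - (b.2 : ZMod l)) * X + C ((a.1 : ZMod l) - (b.1 : ZMod l))) = 0 := by
    rw [map_add, map_mul, AdjoinRoot.mk_C, AdjoinRoot.mk_C, AdjoinRoot.mk_X, map_sub, map_sub, map_natCast, map_natCast,
      map_natCast, map_natCast]
    have h' : ((a.1 : QR l D) + (a.2 : QR l D) * AdjoinRoot.root f) - ((b.1 : QR l D) + (b.2 : QR l D) * AdjoinRoot.root f)
        = 0 := sub_eq_zero.2 h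
    rw [← h']
    ring
  rw [AdjoinRoot.mk_eq_zero] at hmk
  have hmon : f.Monic := by rw [hf]; unfold quadPoly; exact monic_X_pow_sub_C _ (by norm_num)
  have hdeg : f.natDegree = 2 := by rw [hf]; unfold quadPoly; exact natDegree_X_pow_sub_C
  by_cases hg : C ((a.2 : ZMod l) - (b.2 : ZMod l)) * X + C ((a.1 : ZMod l) - (b.1 : ZMod l)) = 0
  · have h0 := congrArg (fun q => q.coeff 0) hg
    have h1 := congrArg (fun q => q.coeff 1) hg
    simp only [coeff_add, coeff_C_mul, coeff_X_zero, mul_zero, coeff_C_zero, zero_add, coeff_zero, coeff_X_one, mul_one,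
      coeff_C_succ, add_zero] at h0 h1
    exact ⟨(ZMod.natCast_eq_natCast_iff' _ _ _).1 (sub_eq_zero.1 h0), (ZMod.natCast_eq_natCast_iff' _ _ _).1 (sub_eq_zero.1 h1)⟩
  · exfalso
    refine hmon.not_dvd_of_natDegree_lt hg ?_ hmk
    rw [hdeg]
    exact lt_of_le_of_lt natDegree_linear_le (by norm_num)

/-- `peq = true` means equality in `R`. [folklore] -/
theorem toR_eq_of_peq {a b : ℕ × ℕ} (h : peq l a b = true) : toR l D a = toR l D b := by
  unfold peq at h
  rw [Bool.and_eq_true, beq_iff_eq, beq_iff_eq] at h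
  unfold toR
  rw [← cast_mod a.1, ← cast_mod b.1, ← cast_mod a.2, ← cast_mod b.2, h.1, h.2]

/-- `peq = false` means inequality in `R` (`1 < ℓ`). [folklore] -/
theorem toR_ne_of_peq (hl : 1 < l) {a b : ℕ × ℕ} (h : peq l a b = false) : toR l D a ≠ toR l D b := by
  intro hab
  obtain ⟨h1, h2⟩ := toR_eq hl hab
  unfold peq at h
  simp [h1, h2] at h

end Semantics

/-! ## Soundness -/

section Sound

variable {p : ℕ} [Fact p.Prime]

/-- `lev` of a count vector of length `p` is its Horner value. [folklore] -/
theorem lev_vecFn {l D : ℕ} (r : ℕ × ℕ) {F : List ℕ} (hF : F.length = p) :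
    lev (toR l D r) (vecFn F : ZMod p → ℕ) = toR l D (hornerP l D r F) := by
  rw [toR_hornerP, hF, lev]
  unfold vecFn zch
  exact sum_val_eq_sum_range (fun i => (F.getD i 0 : QR l D) * toR l D r ^ i)

/-- `levc` is `lev` at `r^{p−1}`, i.e. the Horner value at `powP r (p−1)`. [folklore] -/
theorem levc_vecFn {l D : ℕ} (r : ℕ × ℕ) (h : toR l D r ^ p = 1) {F : List ℕ} (hF : F.length = p) :
    levc (toR l D r) (vecFn F : ZMod p → ℕ) = toR l D (hornerP l D (powP l D r (p - 1)) F) := by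
  rw [← lev_pow_pred h, ← toR_powP, lev_vecFn _ hF]

/-- The hole flags are honest: flag `i` of `coverAux … n z z'` says `Γ ≠ 0 ∨ N ≠ 0 ∨ N' ≠ 0` at `(z·r^i, z'·r̄^i)`.
[folklore] -/
theorem coverAux_getD {l D : ℕ} (hl : 1 < l) (r ri w2 wc2 wwc T m mc : ℕ × ℕ) :
    ∀ (n : ℕ) (z z' : ℕ × ℕ) (i : ℕ), (coverAux l D r ri w2 wc2 wwc T m mc n z z').getD i false = true →
      toR l D wc2 * (toR l D z * toR l D r ^ i) ^ 2 + toR l D w2 * (toR l D z' * toR l D ri ^ i) ^ 2 ≠ toR l D wwc ∨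
      (toR l D z' * toR l D ri ^ i) * toR l D m ≠ (toR l D z * toR l D r ^ i) * toR l D T ∨
      (toR l D z * toR l D r ^ i) * toR l D mc ≠ (toR l D z' * toR l D ri ^ i) * toR l D T
  | 0, z, z', i, h => by simp [coverAux] at h
  | n + 1, z, z', 0, h => by
    rw [coverAux, List.getD_cons_zero, Bool.or_eq_true, Bool.or_eq_true] at h
    simp only [pow_zero, mul_one]
    rcases h with (h | h) | h
    · have h' : peq l (padd l (pmul l D wc2 (pmul l D z z)) (pmul l D w2 (pmul l D z' z'))) wwc = false := by
        simpa using h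
      refine Or.inl fun e => toR_ne_of_peq (D := D) hl h' ?_
      simp only [toR_padd, toR_pmul]
      linear_combination e
    · have h' : peq l (pmul l D z' m) (pmul l D z T) = false := by simpa using h
      refine Or.inr (Or.inl fun e => toR_ne_of_peq (D := D) hl h' ?_)
      rw [toR_pmul, toR_pmul]
      exact e
    · have h' : peq l (pmul l D z mc) (pmul l D z' T) = false := by simpa using h
      refine Or.inr (Or.inr fun e => toR_ne_of_peq (D := D) hl h' ?_)
      rw [toR_pmul, toR_pmul]
      exact e
  | n + 1, z, z', i + 1, h => by
    rw [coverAux, List.getD_cons_succ] at h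
    have ih := coverAux_getD hl r ri w2 wc2 wwc T m mc n (pmul l D z r) (pmul l D z' ri) i h
    simp only [toR_pmul, pow_succ'] at ih ⊢
    rw [show toR l D z * (toR l D r * toR l D r ^ i) = toR l D z * toR l D r * toR l D r ^ i by ring,
      show toR l D z' * (toR l D ri * toR l D ri ^ i) = toR l D z' * toR l D ri * toR l D ri ^ i by ring]
    exact ih

/-- **Soundness of one certificate for one hole**: if flag `s.val` of `certCover p W F c` is set, no `G`, `K` solve the
three-set line identity with data `(W, F)` and hole `s`. [folklore] -/
theorem certCover_sound {W F : List ℕ} {c : ℕ × ℕ × ℕ × ℕ} {s : ZMod p}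
    (h : (certCover p W F c).getD s.val false = true) (G : ZMod p → ℕ) (K : ℕ)
    (hid : ∀ τ : ZMod p, (∑ u : ZMod p, lineMat3 (vecFn W) (vecFn F) τ u * G u) + (if s = τ then 1 else 0) = K) :
    False := by
  obtain ⟨l, D, r1, r2⟩ := c
  unfold certCover at h
  dsimp only at h
  split_ifs at h with hc
  swap
  · simp at h
  obtain ⟨hl, hW, hF, hgeom, hDX⟩ := hc
  set r : ℕ × ℕ := (r1, r2) with hr
  set ρ : QR l D := toR l D r with hρ
  -- `Σ_{i<p} ρ^i = 0`, `ρ^p = 1`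
  have hsum : ∑ i ∈ range p, ρ ^ i = 0 := by
    rw [hρ, ← (toR_geomP (l := l) (D := D) r p).1, toR_eq_of_peq hgeom, toR_zero]
  have h1 : ρ ^ p = 1 := pow_eq_one_of_geom_sum_eq_zero hsum
  -- the character sums as Horner values
  have ew : lev ρ (vecFn (q := p) W) = toR l D (hornerP l D r W) := lev_vecFn r hW
  have ewc : levc ρ (vecFn (q := p) W) = toR l D (hornerP l D (powP l D r (p - 1)) W) := levc_vecFn r h1 hW
  have ex : lev ρ (vecFn (q := p) F) = toR l D (hornerP l D r F) := lev_vecFn r hF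
  have exc : levc ρ (vecFn (q := p) F) = toR l D (hornerP l D (powP l D r (p - 1)) F) := levc_vecFn r h1 hF
  have ez : zch ρ s = toR l D r ^ s.val := rfl
  have ez' : zch ρ (-s) = (toR l D r ^ (p - 1)) ^ s.val := by rw [← zch_pow_pred h1]; rfl
  -- `D_X = 0`
  have hD : (lev ρ (vecFn (q := p) F) * levc ρ (vecFn (q := p) W)) ^ 2 +
      (lev ρ (vecFn (q := p) F) * levc ρ (vecFn (q := p) W)) * (levc ρ (vecFn (q := p) F) * lev ρ (vecFn (q := p) W)) +
      (levc ρ (vecFn (q := p) F) * lev ρ (vecFn (q := p) W)) ^ 2 = 0 := by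
    have e := toR_eq_of_peq (D := D) hDX
    simp only [toR_zero, toR_padd, toR_pmul] at e
    rw [ew, ewc, ex, exc]
    linear_combination e
  -- the flag at hole `s`
  have hflag := coverAux_getD hl r (powP l D r (p - 1)) _ _ _ _ _ _ p (1 % l, 0) (1 % l, 0) s.val h
  simp only [toR_one, one_mul, toR_pmul, toR_padd, toR_powP] at hflag
  refine no_line_identity3_of_local hsum (vecFn W) (vecFn F) s hD ?_ G K hid
  rw [ew, ewc, ex, exc, ez, ez']
  rcases hflag with hf | hf | hf
  · exact Or.inl fun e => hf (by linear_combination e)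
  · exact Or.inr (Or.inl fun e => hf (by linear_combination e))
  · exact Or.inr (Or.inr fun e => hf (by linear_combination e))

/-- **Soundness of the datum check.** [folklore] -/
theorem datumChk_sound {W F : List ℕ} {cs : List (ℕ × ℕ × ℕ × ℕ)} (h : datumChk p W F cs = true)
    (G : ZMod p → ℕ) (s : ZMod p) (K : ℕ)
    (hid : ∀ τ : ZMod p, (∑ u : ZMod p, lineMat3 (vecFn W) (vecFn F) τ u * G u) + (if s = τ then 1 else 0) = K) :
    False := by
  unfold datumChk at h
  rw [List.all_eq_true] at h
  have hs := h s.val (List.mem_range.2 (ZMod.val_lt s))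
  rw [List.any_eq_true] at hs
  obtain ⟨L, hL, hLs⟩ := hs
  rw [List.mem_map] at hL
  obtain ⟨c, _, rfl⟩ := hL
  exact certCover_sound hLs G K hid

/-- **Soundness of a block** (semantic shape of `hkill`, `ThreeSetZpCells4Core`; any `K`, any bound `e`). [folklore] -/
theorem blockChk_sound {K e : ℕ} {W : List ℕ} : ∀ {Fs : List (List ℕ)} {css : List (List (ℕ × ℕ × ℕ × ℕ))},
    blockChk p W Fs css = true → ∀ F ∈ Fs, ∀ (G : ZMod p → ℕ) (s : ZMod p), (∀ u, G u ≤ e) →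
      ¬ ∀ τ : ZMod p, (∑ u : ZMod p, lineMat3 (vecFn W) (vecFn F) τ u * G u) + (if s = τ then 1 else 0) = K
  | [], _, _, F, hF, _, _, _, _ => by simp at hF
  | F :: Fs, [], h, _, _, _, _, _, _ => by simp [blockChk] at h
  | F :: Fs, cs :: css, h, F', hF', G, s, hG, hid => by
    rw [blockChk, Bool.and_eq_true] at h
    rcases List.mem_cons.1 hF' with rfl | hmem
    · exact datumChk_sound h.1 G s K hid
    · exact blockChk_sound (e := e) h.2 F' hmem G s hG hid

/-- **Soundness of a block certified by a numeral.** [folklore] -/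
theorem blockChkN_sound {K e N : ℕ} {W : List ℕ} {Fs : List (List ℕ)} (h : blockChkN p W Fs N = true) :
    ∀ F ∈ Fs, ∀ (G : ZMod p → ℕ) (s : ZMod p), (∀ u, G u ≤ e) →
      ¬ ∀ τ : ZMod p, (∑ u : ZMod p, lineMat3 (vecFn W) (vecFn F) τ u * G u) + (if s = τ then 1 else 0) = K :=
  blockChk_sound h

end Sound

/-- Worked instance (`p = 5`, killer `W = {0,0,1,2}` = `[2,1,1,0,0]`, datum `F = [2,0,0,1,0]`): the split prime `ℓ = 11`
with `r = 4` (order `5` mod `11`) certifies it — `D_X ≡ 0 (mod 11)` at `r = 4` and all five holes are refuted. [folklore] -/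
theorem datumChk_example : datumChk 5 [2,1,1,0,0] [2,0,0,1,0] [(11, 0, 4, 0)] = true := by decide

/-- The same for a block of four data with the certificates `(31,4)`, `(11,4)`, `(151,59)`, `(31,4)` packed into one numeral
(format of `certsOfN`; generated and cross-checked by the python twin). [folklore] -/
theorem blockChkN_example : blockChkN 5 [2,1,1,0,0] [[2,0,1,0,0], [2,0,0,1,0], [2,0,0,0,1], [1,1,0,1,0]]
    36695977922056774892394291474097964150360160065686586993002461171868505234246379222672180208431508693778433 = true := by
  decide

end LineUnit

end Summit.MatrixMultiplication.OmegaCensus
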